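import Literature.NumberTheory.EllipticCurves.SelmerCorankAssembly
import Literature.NumberTheory.EllipticCurves.SelmerFiniteProofs
import HarnessLib

/-!
# The corank identity `corank Sel_{p^∞}(E/K) = rank E(K) + corank Ш(E/K)[p^∞]`: discharge

Fourth and last layer (after `Selmer`, `SelmerCorankProofs`, `SelmerCorankAssembly`) for the
named fact `WeierstrassCurve.selmerCorank_eq_mordellWeilRank_add` of
`Literature.NumberTheory.EllipticCurves.Selmer` (Greenberg, *Iwasawa theory for elliptic
curves*, LNM 1716 (1999), §1, pp. 54–57: for an elliptic curve `E` over a number field `K` and a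
prime `p`, `corank_{ℤ_p} Sel_E(K)_p = rank E(K) + corank_{ℤ_p} Ш_E(K)_p`, from the Kummer
sequence `0 → E(K) ⊗ ℚ_p/ℤ_p → Sel_{p^∞}(E/K) → Ш(E/K)[p^∞] → 0`, the Mordell–Weil theorem and
the finiteness of `Ш(E/K)[p]`). The theorem `selmerCorank_eq_mordellWeilRank_add_holds` below
closes it unconditionally: `SelmerCorankAssembly` reduced it
(`selmerCorank_eq_mordellWeilRank_add_of_finite_selmerGroup`: the `p^∞` Kummer theory and the
corank algebra of `SelmerCorankProofs`, Mordell–Weil `MordellWeilTheoremProofs`, divisibility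
of `E(K̄)` `PointDivisibilityProofs`, the Kummer image `SelmerImage`) to the finiteness of the
`n`-Selmer groups (Silverman, *AEC*, Thm. X.4.2(b)), which is now the tree theorem
`WeierstrassCurve.finite_selmerGroup_holds` (file `SelmerFiniteProofs`: Prop. VIII.1.6 and
Lemma X.4.3 from `H1UnramifiedFiniteProofs`, Cor. X.4.4 from the reduction step
`GoodReductionInertia` and the local–global compatibility of inertia `SelmerInertiaProofs`).
A separate file only because `SelmerCorankAssembly` predates `SelmerFiniteProofs`.

## References

* [Greenberg1999LNM] R. Greenberg, *Iwasawa theory for elliptic curves*, in: Arithmetic theory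
  of elliptic curves (Cetraro, 1997), LNM 1716, Springer 1999, pp. 51–144: §1, pp. 54–57.
* [SilvermanAEC2009] J. H. Silverman, *The Arithmetic of Elliptic Curves*, 2nd ed., GTM 106,
  Springer 2009: Thm. X.4.2(b).
-/

noncomputable section

open scoped Classical

universe u

namespace WeierstrassCurve

open NumberField

variable {K : Type u} [Field K] [NumberField K] (W : WeierstrassCurve K)

/-- **Discharge of `WeierstrassCurve.selmerCorank_eq_mordellWeilRank_add`** (Greenberg, LNM 1716,
§1, pp. 54–57: `corank_{ℤ_p} Sel_E(K)_p = rank E(K) + corank_{ℤ_p} Ш_E(K)_p`), unconditionally: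
`selmerCorank_eq_mordellWeilRank_add_of_finite_selmerGroup` (`SelmerCorankAssembly`) fed with the
finiteness of the `n`-Selmer groups `finite_selmerGroup_holds` (`SelmerFiniteProofs`, Silverman
AEC Thm. X.4.2(b)). [cite: Greenberg1999LNM, §1 pp. 54–57] -/
theorem selmerCorank_eq_mordellWeilRank_add_holds : W.selmerCorank_eq_mordellWeilRank_add :=
  W.selmerCorank_eq_mordellWeilRank_add_of_finite_selmerGroup W.finite_selmerGroup_holds

end WeierstrassCurve
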